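import Summits.ABC.ABC.Theses.CubicResolventAllowance
import Summits.ABC.ABC.Theorems.PlaceCountSzpiroDiscLeJHeight
import Literature.NumberTheory.EllipticCurves.PastenValuationProduct
import Literature.NumberTheory.EllipticCurves.SzpiroSmallJDenominator
import Literature.NumberTheory.DiophantineGeometry.Conductor
import HarnessLib

/-!
# STUB-IDEAS `stub_complexCubic` · ideator k1 · generation 4 — typed helper statements

Crux stmt-ABC-22740 `CubicResolventAllowance.IndexSzpiro`, stub `stub_complexCubic` (the `d_K < 0` half),
route-ABC-CubicResolventAllowance. FAMILY 1 (recognise & import), gen 4 — four items, all BY NAME: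

* **T1 threshold absorption** (`StubEventually ↔ Stub`): the eventual form "for `N_E ≥ N₀(ε)`" is
  equivalent to the stub, the finitely many conductors below `N₀` being absorbed into the constant by
  Shafarevich's theorem in conductor form — the tree's named fact
  `Literature.NumberTheory.EllipticCurves.shafarevich_minimalDiscriminantNorm_bounded` (AEC IX.6.1), which is
  DISCHARGED in the tree (`…_holds`, `PastenValuationProductShafarevichProofs`; see `StubIdeas1G4Holds.lean`).
  PROVED here with the fact as a named hypothesis (T1a), converse T1c, iff T1d.
* **B1″ / P1 denominator currency**: `den(j_E) ≤ A·N^{1+ε}` ⇒ the stub inequality with `C = 2⁸A`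
  (tree theorem `Summit.ABC.ABC.Theorems.minimalDiscriminantNorm_dvd_den_j_mul`, `|Δ_min| ∣ 2⁸·den(j)·N⁵`),
  PROVED; and Pasten 2023 Cor 2.1 (`Pasten2023_cor_2_1`, named fact `h(j_E) ≤ 16 N log N`) puts the whole
  log-denominator family `den(j) ≤ A·h(j)` (⊇ Pasten 2023 Thm 1.2 / Cor 1.3, `den j ≤ A log num j`) inside B1″, PROVED.
* **S1 Serre-level recognition**: the allowance `|d_K|` is `2^{v₂(d_K)} · N(ρ̄_{E,2})` (Serre level of the
  mod-2 representation: `F₂[E[2]] ⊕ 1 = F₂³` as `S₃`-modules, Artin conductors of permutation modules are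
  characteristic-free, conductor–discriminant formula), hence `|d_K|_{odd} ∣ N_E` (Carayol; for `E[2]`:
  `a_p(E[2]) ≤ a_p(T₂E)`); typed in elementary currency as S1loc (`f_p = 1 ⇒ v_p(d_K) ≤ 1`, the one new
  local lemma: Tate curve ⇒ `ψ₂` has a `ℚ_p`-root ⇒ `p = 𝔭₁·𝔮`, `f(𝔭₁) = 1` ⇒ `v_p(d_K) = v_p(d(𝔮)) ≤ 1`)
  and S1 (`|d_K| ∣ 1944·N_E`, sharpening the CLOSED item `ResolventDiscBounds`' `1944·N_E²`); payoff S1pay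
  (`IndexSzpiro ⇒ Δ_min ≤ C·N^{7+ε}` on the irreducible class) PROVED from S1 as a hypothesis.

Statements with `sorry` (S1loc, S1) are the proposals; everything else is kernel-checked. Nothing here
proves the stub; A-PS is NOT abc. Scratch namespace; not a tree proposal.
-/

set_option linter.dupNamespace false

noncomputable section

namespace Summit.ABC.ABC.Cruxes.IndexSzpiro.StubIdeasComplexCubic1G4

open Polynomial
open WeierstrassCurve Height
open Literature.NumberTheory.EllipticCurves

/-- The stub, verbatim (payload `stub.signature`). -/
def Stub : Prop :=
  ∀ ε : ℝ, 0 < ε → ∃ C : ℝ, ∀ (W : WeierstrassCurve ℚ) [W.IsElliptic] (K : Type) [Field K]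
    [NumberField K], Irreducible W.twoTorsionPolynomial.toPoly → Module.finrank ℚ K = 3 →
    (∃ θ : K, aeval θ W.twoTorsionPolynomial.toPoly = 0) → NumberField.discr K < 0 →
    (W.minimalDiscriminantNorm ℤ : ℝ) ≤
      C * |(NumberField.discr K : ℝ)| * (W.conductorNorm ℤ : ℝ) ^ (6 + ε)

/-- The stub's inequality for one curve, one field, constants `(C, ε)` (as in the gen-3 sketch). -/
def Ineq (C ε : ℝ) (W : WeierstrassCurve ℚ) (K : Type) [Field K] [NumberField K] : Prop :=
  (W.minimalDiscriminantNorm ℤ : ℝ) ≤ C * |(NumberField.discr K : ℝ)| * (W.conductorNorm ℤ : ℝ) ^ (6 + ε)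

/-! ## T1 — threshold absorption by name (Shafarevich, AEC IX.6.1, conductor form) -/

/-- **T1 (eventual form).** The stub for conductors `N_E ≥ N₀(ε)` only — the shape in which every
threshold-type statement ("`N ≫_ε 1`": Pasten 2024 Thm 1.9 / Cor 16.2, sieve- or counting-type rungs,
`Filter.Eventually` typings) arrives. -/
def StubEventually : Prop :=
  ∀ ε : ℝ, 0 < ε → ∃ N₀ : ℕ, ∃ C : ℝ, ∀ (W : WeierstrassCurve ℚ) [W.IsElliptic] (K : Type) [Field K]
    [NumberField K], Irreducible W.twoTorsionPolynomial.toPoly → Module.finrank ℚ K = 3 →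
    (∃ θ : K, aeval θ W.twoTorsionPolynomial.toPoly = 0) → NumberField.discr K < 0 →
    N₀ ≤ W.conductorNorm ℤ →
    (W.minimalDiscriminantNorm ℤ : ℝ) ≤
      C * |(NumberField.discr K : ℝ)| * (W.conductorNorm ℤ : ℝ) ^ (6 + ε)

/-- **T1a (S, PROVED).** Threshold absorption with Shafarevich's conductor-form finiteness BY NAME:
below `N₀` the values `|Δ_min|` are bounded by `D(N₀)`, and `|d_K| · N^{6+ε} ≥ 1`, so `C ↦ max C D`. -/
theorem stub_of_eventually_of_shafarevich
    (hSh : shafarevich_minimalDiscriminantNorm_bounded) (h : StubEventually) : Stub := by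
  intro ε hε
  obtain ⟨N₀, C, hC⟩ := h ε hε
  obtain ⟨D, hD⟩ := hSh N₀
  refine ⟨max C D, ?_⟩
  intro W _ K _ _ hirr h3 hθ hd
  have hdK : (1 : ℝ) ≤ |(NumberField.discr K : ℝ)| := by
    have h1 : (1 : ℤ) ≤ |NumberField.discr K| := Int.one_le_abs (NumberField.discr_ne_zero K)
    exact_mod_cast h1
  have hN1 : (1 : ℝ) ≤ (W.conductorNorm ℤ : ℝ) := by
    have h1 : 0 < W.conductorNorm ℤ := W.conductorNorm_pos_holds
    exact_mod_cast h1
  have hpow : (1 : ℝ) ≤ (W.conductorNorm ℤ : ℝ) ^ (6 + ε) := Real.one_le_rpow hN1 (by linarith)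
  have hprod : (1 : ℝ) ≤ |(NumberField.discr K : ℝ)| * (W.conductorNorm ℤ : ℝ) ^ (6 + ε) :=
    one_le_mul_of_one_le_of_one_le hdK hpow
  have hX : (0 : ℝ) ≤ |(NumberField.discr K : ℝ)| * (W.conductorNorm ℤ : ℝ) ^ (6 + ε) :=
    le_trans zero_le_one hprod
  by_cases hN : N₀ ≤ W.conductorNorm ℤ
  · have h1 := hC W K hirr h3 hθ hd hN
    calc (W.minimalDiscriminantNorm ℤ : ℝ)
        ≤ C * |(NumberField.discr K : ℝ)| * (W.conductorNorm ℤ : ℝ) ^ (6 + ε) := h1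
      _ = C * (|(NumberField.discr K : ℝ)| * (W.conductorNorm ℤ : ℝ) ^ (6 + ε)) := by ring
      _ ≤ max C D * (|(NumberField.discr K : ℝ)| * (W.conductorNorm ℤ : ℝ) ^ (6 + ε)) :=
          mul_le_mul_of_nonneg_right (le_max_left _ _) hX
      _ = max C D * |(NumberField.discr K : ℝ)| * (W.conductorNorm ℤ : ℝ) ^ (6 + ε) := by ring
  · have h2 : W.minimalDiscriminantNorm ℤ ≤ D := hD W (not_le.mp hN)
    have h2' : (W.minimalDiscriminantNorm ℤ : ℝ) ≤ (D : ℝ) := by exact_mod_cast h2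
    calc (W.minimalDiscriminantNorm ℤ : ℝ) ≤ (D : ℝ) * 1 := by simpa using h2'
      _ ≤ max C D * (|(NumberField.discr K : ℝ)| * (W.conductorNorm ℤ : ℝ) ^ (6 + ε)) :=
          mul_le_mul (le_max_right _ _) hprod zero_le_one
            (le_trans (Nat.cast_nonneg D) (le_max_right _ _))
      _ = max C D * |(NumberField.discr K : ℝ)| * (W.conductorNorm ℤ : ℝ) ^ (6 + ε) := by ring

/-- **T1c (S, PROVED).** Converse (`N₀ := 0`). -/
theorem eventually_of_stub (h : Stub) : StubEventually := by
  intro ε hε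
  obtain ⟨C, hC⟩ := h ε hε
  exact ⟨0, C, fun W _ K _ _ hirr h3 hθ hd _ => hC W K hirr h3 hθ hd⟩

/-- **T1d (S, PROVED).** `Stub ↔ StubEventually` given the named fact; the unconditional `iff` is in
`StubIdeas1G4Holds.lean` (the fact is discharged in the tree). -/
theorem stub_iff_eventually_of_shafarevich (hSh : shafarevich_minimalDiscriminantNorm_bounded) :
    Stub ↔ StubEventually :=
  ⟨eventually_of_stub, stub_of_eventually_of_shafarevich hSh⟩

/-! ## B1″ / P1 — denominator currency (tree theorem + Pasten 2023 Cor 2.1 by name) -/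

/-- **B1″ (S, PROVED).** `den(j_W) ≤ A·N^{1+ε}` ⇒ `Ineq (2⁸A) ε W K` for EVERY number field `K`
(sign-free, `K`-free). Strictly contains the gen-3 rung B1 (`den j ≤ B`). Source: tree theorem
`Summit.ABC.ABC.Theorems.minimalDiscriminantNorm_dvd_den_j_mul` (`|Δ_min| ∣ 2⁸·den(j)·N⁵`). -/
theorem B1''_ineq_of_den_j_le_pow (A : ℝ) {ε : ℝ} (_hε : 0 < ε) (W : WeierstrassCurve ℚ) [W.IsElliptic]
    (K : Type) [Field K] [NumberField K]
    (hden : ((W.j).den : ℝ) ≤ A * (W.conductorNorm ℤ : ℝ) ^ (1 + ε)) :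
    Ineq (2 ^ 8 * A) ε W K := by
  unfold Ineq
  have hNpos : 0 < W.conductorNorm ℤ := conductorNorm_pos_holds W
  set N : ℝ := (W.conductorNorm ℤ : ℝ) with hNdef
  have hN0 : (0 : ℝ) < N := by rw [hNdef]; exact_mod_cast hNpos
  have hdK : (1 : ℝ) ≤ |(NumberField.discr K : ℝ)| := by
    have h1 : (1 : ℤ) ≤ |NumberField.discr K| := Int.one_le_abs (NumberField.discr_ne_zero K)
    exact_mod_cast h1
  -- `Δ ≤ 2⁸ den(j) N⁵`
  have hdvd := Summit.ABC.ABC.Theorems.minimalDiscriminantNorm_dvd_den_j_mul W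
  have hpos : 0 < 2 ^ 8 * (W.j).den * (W.conductorNorm ℤ) ^ 5 :=
    Nat.mul_pos (Nat.mul_pos (by norm_num) (W.j).den_pos) (pow_pos hNpos 5)
  have hΔle : (W.minimalDiscriminantNorm ℤ : ℝ) ≤ 2 ^ 8 * ((W.j).den : ℝ) * N ^ (5 : ℕ) := by
    have := Nat.le_of_dvd hpos hdvd
    rw [hNdef]
    exact_mod_cast this
  have hA : 0 ≤ A * N ^ (1 + ε) := le_trans (Nat.cast_nonneg _) hden
  have hpow : N ^ (1 + ε) * N ^ (5 : ℕ) = N ^ (6 + ε) := by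
    rw [← Real.rpow_natCast N 5, ← Real.rpow_add hN0]
    norm_num
    ring_nf
  calc (W.minimalDiscriminantNorm ℤ : ℝ) ≤ 2 ^ 8 * ((W.j).den : ℝ) * N ^ (5 : ℕ) := hΔle
    _ ≤ 2 ^ 8 * (A * N ^ (1 + ε)) * N ^ (5 : ℕ) := by gcongr
    _ = 2 ^ 8 * A * 1 * (N ^ (1 + ε) * N ^ (5 : ℕ)) := by ring
    _ ≤ 2 ^ 8 * A * |(NumberField.discr K : ℝ)| * (N ^ (1 + ε) * N ^ (5 : ℕ)) := by
        have hA' : 0 ≤ 2 ^ 8 * A := by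
          have : 0 ≤ A := by
            by_contra hneg
            have hlt : A < 0 := not_le.mp hneg
            have : A * N ^ (1 + ε) < 0 := mul_neg_of_neg_of_pos hlt (Real.rpow_pos_of_pos hN0 _)
            linarith
          positivity
        have hprod : 0 ≤ N ^ (1 + ε) * N ^ (5 : ℕ) := by positivity
        exact mul_le_mul_of_nonneg_right (mul_le_mul_of_nonneg_left hdK hA') hprod
    _ = 2 ^ 8 * A * |(NumberField.discr K : ℝ)| * N ^ (6 + ε) := by rw [hpow]

/-- **P1 (S, PROVED).** Pasten 2023 Cor 2.1 BY NAME (`h(j_E) ≤ 16·N·log N`, named fact, from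
Murty–Pasten's modular bound) puts the log-denominator family inside B1″: `den(j) ≤ A·h(j)` ⇒
`den(j) ≤ (16A/ε)·N^{1+ε}` (using `log N ≤ N^ε/ε`). Pasten's printed hypothesis `den j ≤ A log num j`
(Thm 1.2 / Cor 1.3) is the sub-case `log num j ≤ h(j)`. -/
theorem P1_den_le_pow_of_den_le_height (h21 : Pasten2023_cor_2_1) {A ε : ℝ} (hA : 0 ≤ A) (hε : 0 < ε)
    (W : WeierstrassCurve ℚ) [W.IsElliptic] (hden : ((W.j).den : ℝ) ≤ A * logHeight₁ W.j) :
    ((W.j).den : ℝ) ≤ 16 * A / ε * (W.conductorNorm ℤ : ℝ) ^ (1 + ε) := by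
  have hNpos : 0 < W.conductorNorm ℤ := conductorNorm_pos_holds W
  set N : ℝ := (W.conductorNorm ℤ : ℝ) with hNdef
  have hN0 : (0 : ℝ) < N := by rw [hNdef]; exact_mod_cast hNpos
  have h1 : logHeight₁ W.j ≤ 16 * N * Real.log N := h21 W
  have hlog : Real.log N ≤ N ^ ε / ε := Real.log_le_rpow_div hN0.le hε
  calc ((W.j).den : ℝ) ≤ A * logHeight₁ W.j := hden
    _ ≤ A * (16 * N * Real.log N) := mul_le_mul_of_nonneg_left h1 hA
    _ ≤ A * (16 * N * (N ^ ε / ε)) := by gcongr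
    _ = 16 * A / ε * (N ^ (1 : ℝ) * N ^ ε) := by rw [Real.rpow_one]; field_simp
    _ = 16 * A / ε * N ^ (1 + ε) := by rw [← Real.rpow_add hN0]

/-- **B1″ ∘ P1 (S, PROVED).** The log-denominator family satisfies the stub inequality with
`C = 2⁸·16A/ε`, for every `K` — conditional only on the named fact `Pasten2023_cor_2_1`. -/
theorem ineq_of_den_le_height (h21 : Pasten2023_cor_2_1) {A ε : ℝ} (hA : 0 ≤ A) (hε : 0 < ε)
    (W : WeierstrassCurve ℚ) [W.IsElliptic] (K : Type) [Field K] [NumberField K]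
    (hden : ((W.j).den : ℝ) ≤ A * logHeight₁ W.j) :
    Ineq (2 ^ 8 * (16 * A / ε)) ε W K :=
  B1''_ineq_of_den_j_le_pow (16 * A / ε) hε W K (P1_den_le_pow_of_den_le_height h21 hA hε W hden)

/-! ## S1 — the allowance is the mod-2 Serre level: `|d_K|_{odd} ∣ N_E` -/

/-- **S1loc (M; the one NEW local lemma, "Tate parity cap").** At an odd prime of multiplicative
reduction (`f_p = 1`) the 2-division cubic field is at most simply ramified: `v_p(d_K) ≤ 1`.
Route: Tate curve ⇒ `ψ₂` has a root in `ℚ_p` (ideator 3's `TowerPrimeHasLocalRoot`) ⇒ `p𝓞_K = 𝔭₁·𝔮`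
with `e(𝔭₁) = f(𝔭₁) = 1` (Kummer–Dedekind / Hensel) ⇒ `v_p(d_K) = v_p(d(𝔮 part)) ≤ 1` (tame, via the
tree's `padicValNat_discr_le_sum`, `sum_multiplicity_mul_inertiaDeg_le_of_forall_not_dvd`). Galois
reading: the inertia image in `GL₂(𝔽₂) = S₃` has order `≤ 2` (`ℚ_p(E[2]) = ℚ_p(√q)`). -/
theorem S1loc_padicValNat_discr_le_one (W : WeierstrassCurve ℚ) [W.IsElliptic] (K : Type) [Field K]
    [NumberField K] (hirr : Irreducible W.twoTorsionPolynomial.toPoly) (h3 : Module.finrank ℚ K = 3)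
    (hθ : ∃ θ : K, aeval θ W.twoTorsionPolynomial.toPoly = 0) {p : ℕ} (hp : p.Prime) (hp2 : p ≠ 2)
    (hmult : (W.conductorNorm ℤ).factorization p = 1) :
    padicValNat p (NumberField.discr K).natAbs ≤ 1 := by
  sorry

/-- **S1 (statement).** `|d_K| ∣ 2³·3⁵·N_E` on the irreducible class — prime by prime: `f_p = 0 ⇒
v_p(d_K) = 0` (tree `not_dvd_discr_divisionField_two`, Néron–Ogg–Shafarevich), `f_p = 1 ⇒ v_p(d_K) ≤ 1`
(S1loc), `f_p = 2 ⇒ v_p(d_K) ≤ 2` (tree tame cap `padicValNat_discr_le_of_finrank_lt`, `p ≥ 5`),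
`v₂ ≤ 3`, `v₃ ≤ 5` (tree `padicValNat_two_discr_le_three`, `padicValNat_three_discr_le_five`).
Serre-level form: `|d_K| = 2^{v₂(d_K)}·N(ρ̄_{E,2})` and `N(ρ̄_{E,2}) ∣ N_E` (which also gives the sharp
`v₃(d_K) ≤ f₃`, not claimed here). Sharpens the CLOSED `ResolventDiscBounds` (`∣ 1944·N_E²`). -/
def DiscrDvdConductor : Prop :=
  ∀ (W : WeierstrassCurve ℚ) [W.IsElliptic] (K : Type) [Field K] [NumberField K],
    Irreducible W.twoTorsionPolynomial.toPoly → Module.finrank ℚ K = 3 →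
    (∃ θ : K, aeval θ W.twoTorsionPolynomial.toPoly = 0) →
    (NumberField.discr K).natAbs ∣ 1944 * W.conductorNorm ℤ

/-- **S1 (M, proposal).** -/
theorem S1_discrDvdConductor : DiscrDvdConductor := by
  sorry

/-- **S1♯ (L, the sharp Serre-level form; Galois route, by name).** `|d_K| ∣ 8·N_E`: for odd `p`,
`v_p(d_K) = a_p(ρ̄_{E,2})` (conductor–discriminant formula for the `S₃`-cubic: `Ind_{G_K}^{G_ℚ} 1 =
1 ⊕ σ`, `σ mod 2 = E[2]`, and `dim ℂ[X]^H = #orbits = dim 𝔽₂[X]^H` for every inertia subgroup `H`,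
so Artin exponents agree) and `a_p(ρ̄_{E,2}) ≤ a_p(V₂E) = f_p(E)` — in the tree BY NAME:
`WeierstrassCurve.IsTorsionGaloisRep.artinConductorExponent_baseChange_le` (Serre 1987 §4.6) and the
Ogg–Saito fact `WeierstrassCurve.artinConductorExponent_tate_eq_conductorExponent_of_isElliptic`
(proved for semistable / no additive reduction at 2, 3); `v₂(d_K) ≤ 3` (tree). The missing tree piece
is the conductor–discriminant identity for a non-Galois cubic (Artin conductors of induced
characters are not in the tree) — hence L; S1 (`∣ 1944·N_E`) is the elementary M-version. -/
def DiscrDvdEightConductor : Prop :=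
  ∀ (W : WeierstrassCurve ℚ) [W.IsElliptic] (K : Type) [Field K] [NumberField K],
    Irreducible W.twoTorsionPolynomial.toPoly → Module.finrank ℚ K = 3 →
    (∃ θ : K, aeval θ W.twoTorsionPolynomial.toPoly = 0) →
    (NumberField.discr K).natAbs ∣ 8 * W.conductorNorm ℤ

/-- S1♯ ⇒ S1 (`8 ∣ 1944`). -/
theorem discrDvdConductor_of_eight (h : DiscrDvdEightConductor) : DiscrDvdConductor := by
  intro W _ K _ _ hirr h3 hθ
  exact (h W K hirr h3 hθ).trans (Nat.mul_dvd_mul_right (by norm_num) _)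

/-- **S1pay (S, PROVED from S1).** With the allowance inside the conductor, the crux `IndexSzpiro`
is sandwiched on the irreducible class: `Szpiro(6+ε)|_𝒞 ⇒ IndexSzpiro ⇒ Szpiro(7+ε)|_𝒞`
(the route's recorded payoff exponent via `ResolventDiscBounds` is `8+ε`). -/
theorem S1pay_szpiro_seven_of_indexSzpiro (hS1 : DiscrDvdConductor)
    (h : Summit.ABC.ABC.Theses.CubicResolventAllowance.IndexSzpiro) :
    ∀ ε : ℝ, 0 < ε → ∃ C : ℝ, ∀ (W : WeierstrassCurve ℚ) [W.IsElliptic] (K : Type) [Field K]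
      [NumberField K], Irreducible W.twoTorsionPolynomial.toPoly → Module.finrank ℚ K = 3 →
      (∃ θ : K, aeval θ W.twoTorsionPolynomial.toPoly = 0) →
      (W.minimalDiscriminantNorm ℤ : ℝ) ≤ C * (W.conductorNorm ℤ : ℝ) ^ (7 + ε) := by
  intro ε hε
  obtain ⟨C, hC⟩ := h ε hε
  refine ⟨1944 * max C 0, ?_⟩
  intro W _ K _ _ hirr h3 hθ
  have hNpos : 0 < W.conductorNorm ℤ := conductorNorm_pos_holds W
  set N : ℝ := (W.conductorNorm ℤ : ℝ) with hNdef
  have hN0 : (0 : ℝ) < N := by rw [hNdef]; exact_mod_cast hNpos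
  have hdvd := hS1 W K hirr h3 hθ
  have hle : (NumberField.discr K).natAbs ≤ 1944 * W.conductorNorm ℤ :=
    Nat.le_of_dvd (Nat.mul_pos (by norm_num) hNpos) hdvd
  have hcast : (((NumberField.discr K).natAbs : ℕ) : ℝ) = |(NumberField.discr K : ℝ)| := by
    rw [← Int.cast_natCast, Int.natCast_natAbs, Int.cast_abs]
  have hdle : |(NumberField.discr K : ℝ)| ≤ 1944 * N := by
    rw [← hcast, hNdef]
    exact_mod_cast hle
  have h1 := hC W K hirr h3 hθ
  have hpowN : (0 : ℝ) ≤ N ^ (6 + ε) := Real.rpow_nonneg hN0.le _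
  calc (W.minimalDiscriminantNorm ℤ : ℝ) ≤ C * |(NumberField.discr K : ℝ)| * N ^ (6 + ε) := h1
    _ ≤ max C 0 * |(NumberField.discr K : ℝ)| * N ^ (6 + ε) :=
        mul_le_mul_of_nonneg_right (mul_le_mul_of_nonneg_right (le_max_left _ _) (abs_nonneg _)) hpowN
    _ ≤ max C 0 * (1944 * N) * N ^ (6 + ε) :=
        mul_le_mul_of_nonneg_right (mul_le_mul_of_nonneg_left hdle (le_max_right _ _)) hpowN
    _ = 1944 * max C 0 * (N ^ (1 : ℝ) * N ^ (6 + ε)) := by rw [Real.rpow_one]; ring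
    _ = 1944 * max C 0 * N ^ (7 + ε) := by
        rw [← Real.rpow_add hN0, show (1 : ℝ) + (6 + ε) = 7 + ε by ring]

end Summit.ABC.ABC.Cruxes.IndexSzpiro.StubIdeasComplexCubic1G4

end
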